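import Summits.QuantumFields.YangMills.Theorems.BalabanUVNodesN18RunDifferenceOfLocalTermsRecord
import Summits.QuantumFields.YangMills.Theorems.BalabanUVNodesN22AtU3OfKernels

/-!
# BalabanUVNodes ∕ N18 — THE TERMWISE RUN-DIFFERENCE ROAD, PART 3: A6 SMOKE TEST — the two reading-level capstones of PART 2 §4 FIRE at the zero probe chart `ρ = 0`
# (every windowed kernel vanishes, dag-n23-b's `Record8Inhabited.polWindow_zeroChart`), for EVERY family of cluster towers `S`, EVERY reading maps `emb`, EVERY window radius
# (Track A, DAG node N18 = NE5; key K3⁸ `SpineGivenEndpointR13SepCoPHV` = stmt-QuantumFields-27366; cell `pub-ymgap`, WIDTH SEAT `pub-ymgap-dag-n18-w2` g9, FILE 3;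
# `--kind proof --supports stmt-QuantumFields-27366 --as helper`, COUNT-NEUTRAL; THEOREMS ONLY, 0 `def`, 0 `sorry`)

WHY.  Director-ym №189 (A6): «a theorem whose hypotheses are uninhabited is VACUOUS — inhabit your antecedent in the same file or label the filing LOCATED».  PART 2's
capstones `windowedStepRate_localizedSum_one_of_softSum` ∕ `kernelStepRate_localizedSum_of_softSum` carry the Σ-shaped run-difference bounds and the K-uniform soft
majorants (term-level NE5 × the (4.35) tails) as DISPLAYED hypotheses, LOCATED at the record (NODE A ∕ NODE O ∕ the node's content).  THIS FILE certifies — exactly as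
dag-n22-w2's `…N22WindowSoftTwoPointInhabited` did for the NE9 ∕ (D4) capstones — that the hypothesis SHAPES are jointly satisfiable and that the composition (def-W1's domain
matching, the Σ-junction one run up, g8's level shift, dag-n18-w1's (1.21) passage) elaborates END TO END, by firing both capstones at a MODEL: the zero probe chart `ρ = 0`
of the cheap Stage-8 inhabitant (dag-n23-b), at which BOTH runs' windows vanish (`polWindow_zeroChart`; the (1.21) limits exist, dag-n22-w3's `polLimitExists_zeroChart`) — so
the Σ-bounds hold with the zero summands `a := 0`, the majorants with `C_E := 0`, for ANY towers `S : (K : ℕ) → W1.ClusterTower (F.P K) 𝔸 (L^{m′})`, ANY reading maps, ANY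
`γ`, ANY rate `θ ≥ 0`; numerics `δ₀ := 1`, `κ := 2κ₀(64, 8)`.

WHAT.  ★ `windowedStepRate_localizedSum_one_of_softSum_fires_zeroChart` · ★ `kernelStepRate_localizedSum_of_softSum_fires_zeroChart`.

HONEST (binding).  A DEGENERATE witness (the zero chart is not print's `su(N) ↪ M_N(ℂ)` chart `θ.ρ8`; the two-run letter it yields has constant `0`); it certifies non-vacuity of
the binder shapes only — the record-level theorems of PART 2 §5∕§6 stay conditional on W1-20's law `Localizes17OfRecord₁₃` (nobody's theorem) and are NOT fired here.  Nothing of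
Bałaban's asserted; N18 NOT discharged; K3⁸ OPEN, not claimed; counts UNMOVED (typed 28∕28 · discharged 5∕27 (A 5∕28)); one finite 𝕋⁴ programme at fixed ε — R4 closes the
CONDITIONAL rung `BalabanLadder.UV` only; the YM mass gap (Clay) is NOT proved by any of this.
-/

noncomputable section

namespace YMDAG.N18.RunDifferenceOfLocalTerms

open Filter
open scoped BigOperators Topology
open Literature.MathematicalPhysics.QuantumFieldTheory.Balaban1983to89
open Literature.MathematicalPhysics.QuantumFieldTheory.Balaban1983to89.T4Continuum (T4Family)
open Literature.MathematicalPhysics.QuantumFieldTheory.Balaban1983to89.T4OutputRate (Window)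
open Literature.MathematicalPhysics.QuantumFieldTheory.Balaban1983to89.Node00 (polWindow)
open Literature.MathematicalPhysics.QuantumFieldTheory.Balaban1983to89.Node00.LocalizedSum17 (localizedSum ReadingMaps)
open Literature.MathematicalPhysics.QuantumFieldTheory.Balaban1983to89.Node00.W1 (ClusterTower)
open Literature.MathematicalPhysics.QuantumFieldTheory.Balaban1983to89.Node00.U3KernelLetters (WindowedStepRate KernelStepRate PolLimitsExist)
open Literature.MathematicalPhysics.QuantumFieldTheory.Balaban1983to89.Node00.Record8Inhabited (polWindow_zeroChart)
open Literature.MathematicalPhysics.QuantumFieldTheory.Balaban1983to89.B12Decay510 (delta1)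
open Literature.MathematicalPhysics.QuantumFieldTheory.Balaban1983to89.B12Decay510Window (K₁)
open Literature.MathematicalPhysics.QuantumFieldTheory.Balaban1983to89.B12TreeDecay (K₀ kappa₀)
open YMDAG.N22.AtKernels (polLimitExists_zeroChart)

variable {𝔄 : Type*} [NormedRing 𝔄] [NormedAlgebra ℝ 𝔄] {V : Type*} [NormedAddCommGroup V] [NormedSpace ℝ V] {ι : Type*} [Fintype ι]
variable (F : T4Family)

/-- ★ **A6 — THE `WindowedStepRate` CAPSTONE FIRES AT THE ZERO PROBE CHART**: for every cube exponent `m′`, every family of cluster towers `S`, every reading maps `emb`, every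
colour basis `bV`, every window radius `γ` and every rate `θ ≥ 0`, the hypotheses of PART 2's `windowedStepRate_localizedSum_one_of_softSum` hold at `ρ = 0` with `a := 0`,
`C_E := 0`, `δ₀ := 1`, `κ := 2κ₀(64,8)` (BOTH runs' windowed kernels vanish on `T^{(k+2)}_{K+1}`: `polWindow_zeroChart`), and the capstone yields
`WindowedStepRate F (localizedSum F S emb) 0 bV γ 1 δ₁ θ (0·…·θ)`.  Degenerate, declared. -/
theorem windowedStepRate_localizedSum_one_of_softSum_fires_zeroChart (m' : ℕ) {𝔸 : Type*} [NeZero (F.L ^ m')]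
    (S : (K : ℕ) → ClusterTower (F.P K) 𝔸 (F.L ^ m')) (emb : ReadingMaps F 𝔄 𝔸) (bV : Module.Basis ι ℝ V) (γ : ℝ) {θ : ℝ} (hθ : 0 ≤ θ) :
    WindowedStepRate F (localizedSum F S emb) (0 : V →L[ℝ] 𝔄) bV γ 1 (delta1 1 (2 * kappa₀ (4 * 2 ^ 4) (2 * 4)) (((F.L ^ m' : ℕ) : ℝ) * 4)) θ
      (0 * Real.exp (delta1 1 (2 * kappa₀ (4 * 2 ^ 4) (2 * 4)) (((F.L ^ m' : ℕ) : ℝ) * 4) * (((F.L ^ m' : ℕ) : ℝ) * 4) * 3) *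
        K₀ (4 * 2 ^ 4) (2 * 4) * K₁ 4 (1 / 2) * θ) :=
  windowedStepRate_localizedSum_one_of_softSum F m' (F.L ^ m') rfl S emb 0 bV le_rfl hθ one_pos (by linarith)
    (fun _ _ _ _ _ _ _ => 0)
    (fun k w _ μ ν z K => by
      rw [polWindow_zeroChart, polWindow_zeroChart, sub_self, abs_zero, Finset.sum_const_zero])
    (fun k w _ μ ν z K X => by simp only [zero_mul]; exact le_rfl)

/-- ★ **A6 — NODE N18's LETTER CAPSTONE FIRES AT THE ZERO PROBE CHART** likewise: the (1.21) limits exist at `ρ = 0` (dag-n22-w3's `polLimitExists_zeroChart`), so PART 2's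
`kernelStepRate_localizedSum_of_softSum` yields `KernelStepRate F (localizedSum F S emb) 0 bV γ δ₁ θ (0·…)` for every `S`, `emb`, `bV`, `γ`, `θ ≥ 0`.  Degenerate, declared. -/
theorem kernelStepRate_localizedSum_of_softSum_fires_zeroChart (m' : ℕ) {𝔸 : Type*} [NeZero (F.L ^ m')]
    (S : (K : ℕ) → ClusterTower (F.P K) 𝔸 (F.L ^ m')) (emb : ReadingMaps F 𝔄 𝔸) (bV : Module.Basis ι ℝ V) (γ : ℝ) {θ : ℝ} (hθ : 0 ≤ θ) :
    KernelStepRate F (localizedSum F S emb) (0 : V →L[ℝ] 𝔄) bV γ (delta1 1 (2 * kappa₀ (4 * 2 ^ 4) (2 * 4)) (((F.L ^ m' : ℕ) : ℝ) * 4)) θ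
      (0 * Real.exp (delta1 1 (2 * kappa₀ (4 * 2 ^ 4) (2 * 4)) (((F.L ^ m' : ℕ) : ℝ) * 4) * (((F.L ^ m' : ℕ) : ℝ) * 4) * 3) *
        K₀ (4 * 2 ^ 4) (2 * 4) * K₁ 4 (1 / 2)) :=
  kernelStepRate_localizedSum_of_softSum F m' (F.L ^ m') rfl S emb 0 bV (fun g _ k => polLimitExists_zeroChart F bV (k + 1) _) le_rfl hθ one_pos (by linarith)
    (fun _ _ _ _ _ _ _ => 0)
    (fun k w _ μ ν z K => by
      rw [polWindow_zeroChart, polWindow_zeroChart, sub_self, abs_zero, Finset.sum_const_zero])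
    (fun k w _ μ ν z K X => by simp only [zero_mul]; exact le_rfl)

end YMDAG.N18.RunDifferenceOfLocalTerms

end
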